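import Literature.NumberTheory.Transcendental.RivoalSeriesDefs
import HarnessLib

/-!
# Rivoal's very-well-poised series — Stirling estimates for the summand

Topic `Literature/NumberTheory/Transcendental`. Everything in this file is PROVED.

For integers `a ≥ 3`, `1 ≤ r` with `2r < a` and `n ≥ 1`, Rivoal (2000) considers
`S_n = ∑_{k ≥ 0} R_n(k)` with
`R_n(t) = n!^{a-2r} (t-rn+1)_{rn} (t+n+2)_{rn} / (t+1)_{n+1}^a`
(`(x)_m` the Pochhammer symbol). For `k ≥ rn` (the other terms vanish)
`R_n(k) = n!^{a-2r} · k!/(k-rn)! · (k+n+1+rn)!/(k+n+1)! · (k!/(k+n+1)!)^a`, a quotient of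
factorials. This file proves the two-sided Stirling estimate
`m log m − m ≤ log m! ≤ m log m − m + (log m)/2 + 1` (from Mathlib's Stirling bounds) and deduces
the uniform estimate `|log R_n(k) − n Φ(k/n)| ≤ C_a (log(k + (r+2)n + 1) + 1)` where
`Φ(x) = (a+1)(φ(x) − φ(x+1)) + φ(x+r+1) − φ(x−r)`, `φ(y) = y log y` — the elementary
substitute for Rivoal's Lemme 3 (asymptotics of `S_n^{1/n}`) used in
`RivoalSeriesAsymptotics.lean`.

## References

* T. Rivoal, C. R. Acad. Sci. Paris 331 (2000) 267–270, §2 (the series `S_n`, Lemme 3).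
  [Rivoal2000]
* K. Ball, T. Rivoal, Invent. Math. 146 (2001) 193–207, Lemme 3 (second, elementary proof).
  [BallRivoal2001]
-/

noncomputable section

open Real Finset
open scoped Nat

namespace Literature.NumberTheory.Transcendental

namespace RivoalSeries

/-! ### Two-sided Stirling bounds for `log m!` -/

/-- Lower Stirling bound `m log m − m ≤ log m!` for every `m` (Mathlib's
`Stirling.le_log_factorial_stirling`, and `m = 0` by hand). [folklore] -/
theorem log_factorial_ge (m : ℕ) : (m : ℝ) * Real.log m - m ≤ Real.log (m ! : ℝ) := by
  rcases Nat.eq_zero_or_pos m with rfl | hm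
  · simp
  have h := Stirling.le_log_factorial_stirling hm.ne'
  have h1 : 0 ≤ Real.log m / 2 := by
    have : (1 : ℝ) ≤ m := by exact_mod_cast hm
    have := Real.log_nonneg this
    linarith
  have h2 : 0 ≤ Real.log (2 * π) / 2 := by
    have : (1 : ℝ) ≤ 2 * π := by linarith [Real.pi_gt_three]
    have := Real.log_nonneg this
    linarith
  linarith

/-- Upper Stirling bound `log m! ≤ m log m − m + (log m)/2 + 1` for every `m`, from the
antitonicity of Mathlib's `Stirling.stirlingSeq` and `stirlingSeq 1 = e/√2`. [folklore] -/
theorem log_factorial_le (m : ℕ) :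
    Real.log (m ! : ℝ) ≤ (m : ℝ) * Real.log m - m + Real.log m / 2 + 1 := by
  rcases Nat.eq_zero_or_pos m with rfl | hm
  · simp
  obtain ⟨k, rfl⟩ : ∃ k, m = k + 1 := ⟨m - 1, by omega⟩
  have hanti := Stirling.stirlingSeq'_antitone (Nat.zero_le k)
  simp only [Function.comp_apply, Nat.succ_eq_add_one, zero_add, Stirling.stirlingSeq_one] at hanti
  -- `stirlingSeq (k+1) ≤ e / √2`
  have hpos : (0 : ℝ) < √(2 * ((k + 1 : ℕ) : ℝ)) * (((k + 1 : ℕ) : ℝ) / rexp 1) ^ (k + 1) := by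
    positivity
  have hfac : (((k + 1)! : ℕ) : ℝ) ≤ rexp 1 / √2 * (√(2 * ((k + 1 : ℕ) : ℝ)) *
      (((k + 1 : ℕ) : ℝ) / rexp 1) ^ (k + 1)) := by
    have := hanti
    unfold Stirling.stirlingSeq at this
    rwa [div_le_iff₀ hpos] at this
  have hm1 : (1 : ℝ) ≤ ((k + 1 : ℕ) : ℝ) := by exact_mod_cast hm
  have hm0 : (0 : ℝ) < ((k + 1 : ℕ) : ℝ) := by linarith
  have hlog := Real.log_le_log (by positivity) hfac
  have e1 : Real.log (rexp 1 / √2 * (√(2 * ((k + 1 : ℕ) : ℝ)) *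
      (((k + 1 : ℕ) : ℝ) / rexp 1) ^ (k + 1))) =
      1 - Real.log 2 / 2 + (Real.log 2 + Real.log ((k + 1 : ℕ) : ℝ)) / 2 +
        (k + 1 : ℕ) * (Real.log ((k + 1 : ℕ) : ℝ) - 1) := by
    rw [Real.log_mul (by positivity) (by positivity), Real.log_mul (by positivity) (by positivity),
      Real.log_div (by positivity) (by positivity), Real.log_exp, Real.log_sqrt (by norm_num),
      Real.log_sqrt (by positivity), Real.log_mul (by norm_num) hm0.ne', Real.log_pow,
      Real.log_div hm0.ne' (by positivity), Real.log_exp]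
    ring
  rw [e1] at hlog
  have : (((k + 1 : ℕ) : ℝ)) * (Real.log ((k + 1 : ℕ) : ℝ) - 1) =
      ((k + 1 : ℕ) : ℝ) * Real.log ((k + 1 : ℕ) : ℝ) - ((k + 1 : ℕ) : ℝ) := by ring
  linarith

/-- The two bounds combined: `|log m! − (m log m − m)| ≤ log (m+1) + 1`. [folklore] -/
theorem abs_log_factorial_sub_le (m : ℕ) :
    |Real.log (m ! : ℝ) - ((m : ℝ) * Real.log m - m)| ≤ Real.log (m + 1) + 1 := by
  have h1 := log_factorial_ge m
  have h2 := log_factorial_le m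
  have h3 : Real.log m ≤ Real.log (m + 1) := by
    rcases Nat.eq_zero_or_pos m with rfl | hm
    · simp
    · exact Real.log_le_log (by exact_mod_cast hm) (by linarith)
  have h4 : 0 ≤ Real.log ((m : ℝ) + 1) := Real.log_nonneg (by linarith [m.cast_nonneg (α := ℝ)])
  rw [abs_le]
  constructor <;> linarith

/-! ### The function `φ(y) = y log y` -/

/-- Scaling: `φ(n y) = n φ(y) + (n log n) y` for `y ≥ 0`, `n > 0`. [folklore] -/
theorem mul_log_scale {n y : ℝ} (hn : 0 < n) (hy : 0 ≤ y) :
    n * y * Real.log (n * y) = n * (y * Real.log y) + n * Real.log n * y := by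
  rcases eq_or_lt_of_le hy with rfl | hy'
  · simp
  · rw [Real.log_mul hn.ne' hy'.ne']; ring

/-- Shift: for `y > 0`, `h ≥ 0`, `y + h ≥ 1`:
`0 ≤ φ(y+h) − φ(y) ≤ h (1 + log (y+h))`. [folklore] -/
theorem mul_log_shift {y h : ℝ} (hy : 0 < y) (hh : 0 ≤ h) (h1 : 1 ≤ y + h) :
    0 ≤ (y + h) * Real.log (y + h) - y * Real.log y ∧
      (y + h) * Real.log (y + h) - y * Real.log y ≤ h * (1 + Real.log (y + h)) := by
  have hyh : 0 < y + h := by linarith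
  have hlog0 : 0 ≤ Real.log (y + h) := Real.log_nonneg h1
  have hmono : Real.log y ≤ Real.log (y + h) := Real.log_le_log hy (by linarith)
  have key : (y + h) * Real.log (y + h) - y * Real.log y =
      y * (Real.log (y + h) - Real.log y) + h * Real.log (y + h) := by ring
  rw [key]
  constructor
  · have : 0 ≤ y * (Real.log (y + h) - Real.log y) := mul_nonneg hy.le (by linarith)
    have : 0 ≤ h * Real.log (y + h) := mul_nonneg hh hlog0
    linarith
  · have h2 : Real.log (y + h) - Real.log y ≤ h / y := by
      rw [← Real.log_div hyh.ne' hy.ne']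
      have : (y + h) / y = 1 + h / y := by field_simp
      rw [this]
      exact Real.log_le_sub_one_of_pos (by positivity) |>.trans (by linarith)
    have h3 : y * (Real.log (y + h) - Real.log y) ≤ h := by
      calc y * (Real.log (y + h) - Real.log y) ≤ y * (h / y) :=
            mul_le_mul_of_nonneg_left h2 hy.le
        _ = h := by field_simp
    nlinarith

/-! ### The uniform Stirling estimate for `log R_n(m+1)` -/

/-- **Uniform Stirling estimate for Rivoal's summand** (our elementary substitute for the
asymptotic analysis in Rivoal 2000, Lemme 3 / Ball–Rivoal 2001, Lemme 3): for `n ≥ 1`,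
`m ≥ rn`, `2r ≤ a`,
`|log R_n(m+1) − n Φ(m/n)| ≤ 6(a+2)(log(m + (r+1)n + 2) + 1)`.
[cite: Rivoal2000, Lemme 3 (elementary form)] -/
theorem abs_log_ratfun_sub_le (a r n m : ℕ) (h2r : 2 * r ≤ a) (hn : 1 ≤ n) (hm : r * n ≤ m) :
    |Real.log (ratfun a r n ((m + 1 : ℕ) : ℝ)) - n * Phi a r ((m : ℝ) / n)| ≤
      6 * (a + 2) * (Real.log ((m : ℝ) + (r + 1) * n + 2) + 1) := by
  -- notation
  set L : ℕ → ℝ := fun u => Real.log (u ! : ℝ) with hL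
  set gm : ℕ → ℝ := fun u => (u : ℝ) * Real.log u - u with hgm
  have hLg : ∀ u : ℕ, |L u - gm u| ≤ Real.log (u + 1) + 1 := fun u => abs_log_factorial_sub_le u
  have hn0 : (0 : ℝ) < n := by exact_mod_cast hn
  have hmr : ((m - r * n : ℕ) : ℝ) = m - r * n := by rw [Nat.cast_sub hm]; push_cast; ring
  -- Step 1: `log R` as a signed sum of `log`-factorials
  have hR := ratfun_succ_eq a r n m hm
  have hfac : ∀ u : ℕ, (0 : ℝ) < u ! := fun u => by exact_mod_cast Nat.factorial_pos u
  have hlogT : Real.log (ratfun a r n ((m + 1 : ℕ) : ℝ)) =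
      (a - 2 * r : ℕ) * L n + (L m - L (m - r * n)) + (L (m + n + 1 + r * n) - L (m + n + 1)) +
        a * (L m - L (m + n + 1)) := by
    rw [hR]
    rw [Real.log_mul (by positivity) (by positivity), Real.log_mul (by positivity) (by positivity),
      Real.log_mul (by positivity) (by positivity), Real.log_pow, Real.log_pow,
      Real.log_div (hfac _).ne' (hfac _).ne', Real.log_div (hfac _).ne' (hfac _).ne',
      Real.log_div (hfac _).ne' (hfac _).ne']
  -- Step 2: the balance identities
  set x : ℝ := (m : ℝ) / n with hx
  have hxm : (m : ℝ) = n * x := by rw [hx]; field_simp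
  have hx0 : 0 ≤ x := by positivity
  have hxr : (r : ℝ) ≤ x := by
    rw [hx, le_div_iff₀ hn0]; exact_mod_cast hm
  set y₁ : ℝ := x + r + 1 + 1 / n with hy₁
  set y₂ : ℝ := x + 1 + 1 / n with hy₂
  have e1 : ((m - r * n : ℕ) : ℝ) = n * (x - r) := by rw [hmr, hxm]; ring
  have e2 : ((m + n + 1 + r * n : ℕ) : ℝ) = n * y₁ := by
    push_cast; rw [hxm, hy₁]; field_simp; ring
  have e3 : ((m + n + 1 : ℕ) : ℝ) = n * y₂ := by
    push_cast; rw [hxm, hy₂]; field_simp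
  -- `gm` at the five arguments
  have hφ : ∀ {u : ℕ} {y : ℝ}, (u : ℝ) = n * y → 0 ≤ y →
      gm u = n * (y * Real.log y) + n * Real.log n * y - n * y := by
    intro u y hu hy
    simp only [hgm]; rw [hu, mul_log_scale hn0 hy]
  have hg_n : gm n = n * Real.log n - n := by simp [hgm]
  have hg_m : gm m = n * (x * Real.log x) + n * Real.log n * x - n * x := hφ hxm hx0
  have hg_mr : gm (m - r * n) = n * ((x - r) * Real.log (x - r)) + n * Real.log n * (x - r) -
      n * (x - r) := hφ e1 (by linarith)
  have hg_1 : gm (m + n + 1 + r * n) = n * (y₁ * Real.log y₁) + n * Real.log n * y₁ - n * y₁ :=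
    hφ e2 (by rw [hy₁]; positivity)
  have hg_2 : gm (m + n + 1) = n * (y₂ * Real.log y₂) + n * Real.log n * y₂ - n * y₂ :=
    hφ e3 (by rw [hy₂]; positivity)
  -- the main term `Ψ`
  set Ψ : ℝ := (a - 2 * r : ℕ) * gm n + (gm m - gm (m - r * n)) +
      (gm (m + n + 1 + r * n) - gm (m + n + 1)) + a * (gm m - gm (m + n + 1)) with hΨ
  have ha2r : ((a - 2 * r : ℕ) : ℝ) = a - 2 * r := by rw [Nat.cast_sub h2r]; push_cast; ring
  have hΨeq : Ψ = n * ((a + 1) * (x * Real.log x) - (x - r) * Real.log (x - r) +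
      y₁ * Real.log y₁ - (a + 1) * (y₂ * Real.log y₂)) - a * Real.log n + a := by
    simp only [hΨ]
    rw [ha2r, hg_n, hg_m, hg_mr, hg_1, hg_2, hy₁, hy₂]
    field_simp
    ring
  -- Step 3: shift errors
  have hninv : (0 : ℝ) ≤ 1 / n := by positivity
  have hs1 := mul_log_shift (y := x + r + 1) (h := 1 / n) (by positivity) hninv (by linarith)
  have hs2 := mul_log_shift (y := x + 1) (h := 1 / n) (by positivity) hninv (by linarith)
  rw [← hy₁] at hs1
  rw [← hy₂] at hs2
  have hPhi : (n : ℝ) * Phi a r x = n * ((a + 1) * (x * Real.log x) - (x - r) * Real.log (x - r) +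
      (x + r + 1) * Real.log (x + r + 1) - (a + 1) * ((x + 1) * Real.log (x + 1))) := by
    simp only [Phi]; ring
  -- Step 4: size of the logarithms involved
  set ℓ : ℝ := Real.log ((m : ℝ) + (r + 1) * n + 2) with hℓ
  have hbig : (1 : ℝ) ≤ (m : ℝ) + (r + 1) * n + 2 := by
    have : (0 : ℝ) ≤ m := by positivity
    have : (0 : ℝ) ≤ (r + 1 : ℝ) * n := by positivity
    linarith
  have hℓ0 : 0 ≤ ℓ := Real.log_nonneg hbig
  have hlog_le : ∀ {z : ℝ}, 0 < z → z ≤ (m : ℝ) + (r + 1) * n + 2 → Real.log z ≤ ℓ :=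
    fun hz hz' => Real.log_le_log hz hz'
  have hn1 : (1 : ℝ) ≤ n := by exact_mod_cast hn
  have hinv : 1 / (n : ℝ) ≤ 1 := by rw [div_le_one hn0]; exact hn1
  have hinv0 : (0 : ℝ) ≤ 1 / n := by positivity
  have hmdiv : (m : ℝ) / n ≤ m := div_le_self (by positivity) hn1
  have hr' : (r : ℝ) ≤ (r + 1) * n := by
    have : (r : ℝ) * 1 ≤ (r + 1) * n := mul_le_mul (by linarith) hn1 zero_le_one (by positivity)
    linarith
  have hm0 : (0 : ℝ) ≤ m := by positivity
  have hy₁le : y₁ ≤ (m : ℝ) + (r + 1) * n + 2 := by rw [hy₁, hx]; linarith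
  have hy₂le : y₂ ≤ (m : ℝ) + (r + 1) * n + 2 := by rw [hy₂, hx]; linarith
  have hy₁1 : 1 ≤ y₁ := by rw [hy₁]; linarith
  have hy₂1 : 1 ≤ y₂ := by rw [hy₂]; linarith
  have hy₁ℓ : Real.log y₁ ≤ ℓ := hlog_le (by linarith) hy₁le
  have hy₂ℓ : Real.log y₂ ≤ ℓ := hlog_le (by linarith) hy₂le
  have hy₁0 : 0 ≤ Real.log y₁ := Real.log_nonneg hy₁1
  have hy₂0 : 0 ≤ Real.log y₂ := Real.log_nonneg hy₂1
  have hnle : (n : ℝ) ≤ (r + 1) * n := le_mul_of_one_le_left hn0.le (by linarith only [])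
  have hlogn : Real.log n ≤ ℓ := hlog_le hn0 (by linarith only [hm0, hnle])
  have hlogn0 : 0 ≤ Real.log n := Real.log_nonneg hn1
  -- Stirling errors at the five arguments, all `≤ ℓ + 1`
  have hE : ∀ u : ℕ, u ≤ m + n + 1 + r * n → |L u - gm u| ≤ ℓ + 1 := by
    intro u hu
    refine (hLg u).trans ?_
    have hu' : (u : ℝ) ≤ m + n + 1 + r * n := by exact_mod_cast hu
    have : Real.log ((u : ℝ) + 1) ≤ ℓ := hlog_le (by positivity) (by linarith only [hu'])
    linarith only [this]
  have hEn := hE n (by omega)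
  have hEm := hE m (by omega)
  have hEmr := hE (m - r * n) (by omega)
  have hE1 := hE (m + n + 1 + r * n) le_rfl
  have hE2 := hE (m + n + 1) (by omega)
  rw [abs_le] at hEn hEm hEmr hE1 hE2
  -- Step 5: combine
  have hdiff : Real.log (ratfun a r n ((m + 1 : ℕ) : ℝ)) - Ψ =
      (a - 2 * r : ℕ) * (L n - gm n) + ((L m - gm m) - (L (m - r * n) - gm (m - r * n))) +
      ((L (m + n + 1 + r * n) - gm (m + n + 1 + r * n)) - (L (m + n + 1) - gm (m + n + 1))) +
      a * ((L m - gm m) - (L (m + n + 1) - gm (m + n + 1))) := by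
    rw [hlogT]; simp only [hΨ]; ring
  have ha0 : (0 : ℝ) ≤ a := by positivity
  have ha2r0 : (0 : ℝ) ≤ (a - 2 * r : ℕ) := by positivity
  have hup : Real.log (ratfun a r n ((m + 1 : ℕ) : ℝ)) - Ψ ≤ (3 * a + 4) * (ℓ + 1) := by
    rw [hdiff]
    have t1 : ((a - 2 * r : ℕ) : ℝ) * (L n - gm n) ≤ a * (ℓ + 1) := by
      calc ((a - 2 * r : ℕ) : ℝ) * (L n - gm n) ≤ (a - 2 * r : ℕ) * (ℓ + 1) :=
            mul_le_mul_of_nonneg_left hEn.2 ha2r0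
        _ ≤ a * (ℓ + 1) := by
            rw [ha2r]
            have : (0 : ℝ) ≤ 2 * r * (ℓ + 1) := by positivity
            linarith only [this]
    have t4 : (a : ℝ) * ((L m - gm m) - (L (m + n + 1) - gm (m + n + 1))) ≤ a * (2 * (ℓ + 1)) :=
      mul_le_mul_of_nonneg_left (by linarith only [hEm.2, hE2.1]) ha0
    linarith only [t1, t4, hEm.2, hEmr.1, hE1.2, hE2.1]
  have hlow : -((3 * a + 4) * (ℓ + 1)) ≤ Real.log (ratfun a r n ((m + 1 : ℕ) : ℝ)) - Ψ := by
    rw [hdiff]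
    have t1 : -(a * (ℓ + 1)) ≤ ((a - 2 * r : ℕ) : ℝ) * (L n - gm n) := by
      have h1 : ((a - 2 * r : ℕ) : ℝ) * (-(ℓ + 1)) ≤ (a - 2 * r : ℕ) * (L n - gm n) :=
        mul_le_mul_of_nonneg_left hEn.1 ha2r0
      have h2 : -(a * (ℓ + 1)) ≤ ((a - 2 * r : ℕ) : ℝ) * (-(ℓ + 1)) := by
        rw [ha2r]
        have : (0 : ℝ) ≤ 2 * r * (ℓ + 1) := by positivity
        linarith only [this]
      exact h2.trans h1
    have t4 : (a : ℝ) * (-(2 * (ℓ + 1))) ≤ a * ((L m - gm m) - (L (m + n + 1) - gm (m + n + 1))) :=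
      mul_le_mul_of_nonneg_left (by linarith only [hEm.1, hE2.2]) ha0
    linarith only [t1, t4, hEm.1, hEmr.2, hE1.1, hE2.2]
  -- `Ψ − n Φ(x)`
  have hΨΦ : Ψ - n * Phi a r x = n * (y₁ * Real.log y₁ - (x + r + 1) * Real.log (x + r + 1)) -
      (a + 1) * (n * (y₂ * Real.log y₂ - (x + 1) * Real.log (x + 1))) - a * Real.log n + a := by
    rw [hΨeq, hPhi]; ring
  have hup2 : Ψ - n * Phi a r x ≤ (ℓ + 1) + a := by
    rw [hΨΦ]
    have u1 : (n : ℝ) * (y₁ * Real.log y₁ - (x + r + 1) * Real.log (x + r + 1)) ≤ 1 + Real.log y₁ := by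
      calc (n : ℝ) * (y₁ * Real.log y₁ - (x + r + 1) * Real.log (x + r + 1))
          ≤ n * (1 / n * (1 + Real.log y₁)) := mul_le_mul_of_nonneg_left hs1.2 hn0.le
        _ = 1 + Real.log y₁ := by field_simp
    have u2 : 0 ≤ (n : ℝ) * (y₂ * Real.log y₂ - (x + 1) * Real.log (x + 1)) :=
      mul_nonneg hn0.le hs2.1
    have u3 : 0 ≤ (a + 1 : ℝ) * (n * (y₂ * Real.log y₂ - (x + 1) * Real.log (x + 1))) := by
      positivity
    have u4 : 0 ≤ (a : ℝ) * Real.log n := by positivity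
    linarith only [u1, u3, u4, hy₁ℓ]
  have hlow2 : -((a + 1) * (ℓ + 1) + a * ℓ) ≤ Ψ - n * Phi a r x := by
    rw [hΨΦ]
    have u1 : 0 ≤ (n : ℝ) * (y₁ * Real.log y₁ - (x + r + 1) * Real.log (x + r + 1)) :=
      mul_nonneg hn0.le hs1.1
    have u2 : (n : ℝ) * (y₂ * Real.log y₂ - (x + 1) * Real.log (x + 1)) ≤ 1 + Real.log y₂ := by
      calc (n : ℝ) * (y₂ * Real.log y₂ - (x + 1) * Real.log (x + 1))
          ≤ n * (1 / n * (1 + Real.log y₂)) := mul_le_mul_of_nonneg_left hs2.2 hn0.le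
        _ = 1 + Real.log y₂ := by field_simp
    have u3 : (a + 1 : ℝ) * (n * (y₂ * Real.log y₂ - (x + 1) * Real.log (x + 1))) ≤
        (a + 1) * (ℓ + 1) := by
      have := mul_le_mul_of_nonneg_left (u2.trans (by linarith only [hy₂ℓ] : 1 + Real.log y₂ ≤ ℓ + 1))
        (by positivity : (0 : ℝ) ≤ a + 1)
      linarith only [this]
    have u4 : (a : ℝ) * Real.log n ≤ a * ℓ := mul_le_mul_of_nonneg_left hlogn ha0
    linarith only [u1, u3, u4, ha0]
  have hfin1 := hup
  have hfin2 := hlow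
  rw [abs_le]
  constructor
  · have : (0 : ℝ) ≤ a * ℓ := by positivity
    linarith only [hfin2, hlow2, hℓ0, ha0, this]
  · have : (0 : ℝ) ≤ a * ℓ := by positivity
    linarith only [hfin1, hup2, hℓ0, ha0, this]

end RivoalSeries

end Literature.NumberTheory.Transcendental
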